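import Mathlib
import Literature.AlgebraicGeometry.Resolution.Lipman1969RationalSurfaceSingularities
import Literature.AlgebraicGeometry.Resolution.ExceptionalCurvePoints
import Summits.ResolutionOfSingularities.ResolutionOfSingularities.Theorems.HomologicalConductorNoZenoCechIdealFiltration
import Summits.ResolutionOfSingularities.ResolutionOfSingularities.Theorems.HomologicalConductorNoZenoExcOrderStalks
import HarnessLib

/-!
# Route `HomologicalConductor`, crux `NoZenoR` (stmt-ResolutionOfSingularities-19943; twin `NoZeno`
# stmt-16483), line `sandwich-cluster`, S3 G-layer — **G1 = LEMMA L (sheaf half): the annihilator of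
# `Ȟ¹` of a quasi-coherent module on a resolution of a surface singularity is a carried
# (exceptional-valuative) ideal** — part 3/3, the theorem

OURS (cell res-hironaka, crux chain W4.4, seat res-L0-w44-stub-2). Nothing here is a statement of the
manuscript under review (Hironaka 2017); AI-written, weaker than expert review.

For a Noetherian local domain `T` of Krull dimension `2`, a resolution `π : X → Spec T` (proper,
birational, `X` regular) with `T → K(X)` injective, an affine-localizing (quasi-coherent) `𝒪_X`-module
`F`, and a family of affine opens `𝒰` of `X` on which `Ȟ¹(𝒰, ·)` is right exact (this is `H² = 0`
on the curve-fibred `X`, Görtz–Wedhorn II Cor. 24.44 = EGA III (4.2.2), consumed as the hypothesis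
`hRE` and discharged in the tree by `Morphisms.GortzWedhorn2023_24_44_H2.cechMapH1_surjective`), the
annihilator `𝔞 = ann_T Ȟ¹(𝒰, F)`, if it contains a power of `𝔪`, is CARRIED by the exceptional
curves of `π`:

  `t ∈ 𝔞 ↔ t = 0 ∨ ∀ η ∈ excCurvePoints π, Z η ≤ ord_{E_η}(t)`,  `Z η = ord_{E_η}(𝔞𝒪_X)`

(`annihilator_cechMH1_isCarried`; codimension-one form `annihilator_cechMH1_isCarried_coheight`,
which needs no dictionary hypothesis), i.e. `𝔞 = I_Z` is a complete ideal cut out by the finitely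
many divisorial valuations of the exceptional curves — Lemma A (A2)–(A4) of the chain's THEOREM Q-rat
(res-L0-w44-idea-1, `S3-structural-proof.md`; lead audit KERNEL-L0 §14), the input "G1" of the typed
target `Sig.stubG_caCarried` (Ga) of the registered skeleton (res-L0-w44-lead-1, v19).

PROOF ROUTE (ours; it needs neither the affineness of strict transforms nor Mayer–Vietoris): with
`I := 𝔞𝒪_X`, `H := divisorialPart I = ∏ 𝓘_{E_η}^{ord_η I}` and `J := codimTwoPart I` (`H·J = I`,
tree `Resolution/DivisorialPart`, Cossart–Piltant 2008 Prop. 4.2), the quotient `HF/IF` is supported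
on `V(J)`, finitely many closed points of the exceptional fibre, so `Ȟ¹(IF) → Ȟ¹(HF)` is onto; the
image of `Ȟ¹(IF) → Ȟ¹(F)` vanishes by induction on generators of `𝔞` (part 1/3); hence
multiplication by any `t` with `t𝒪_X ≤ H` kills `Ȟ¹(𝒰, F)` (`Modules/IdealMulMaps.globalScalarLift`),
and `t𝒪_X ≤ H` is exactly the carried condition (part 2/3).

References: J. Lipman, Publ. IHÉS 36 (1969) §12 [`Lipman1969`]; V. Cossart, O. Piltant, J. Algebra
320 (2008) Prop. 4.2 [`CossartPiltant2008`]; R. Hartshorne, *Algebraic Geometry* III.4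
[`Hartshorne1977`].
-/

noncomputable section

-- single-problem summit: the doubled namespace component `ResolutionOfSingularities` is forced
set_option linter.dupNamespace false

open CategoryTheory CategoryTheory.Limits AlgebraicGeometry TopologicalSpace Opposite IsLocalRing
open Literature.AlgebraicGeometry.Resolution Literature.AlgebraicGeometry.Morphisms
open Literature.AlgebraicGeometry.Modules

namespace Summit.ResolutionOfSingularities.ResolutionOfSingularities.Theorems.NoZeno.SandwichCluster.LemmaL

universe u

/-! ## Lemma L -/

section Main

variable {T : Type} [CommRing T] [IsNoetherianRing T] [IsLocalRing T] [IsDomain T]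
  {X : Scheme.{0}} [IsIntegral X] [IsLocallyNoetherian X] (π : X ⟶ Spec (.of T))

omit [IsNoetherianRing T] [IsLocalRing T] [IsDomain T] in
/-- The stalk at a codimension-one point of a resolution is a discrete valuation ring. [folklore] -/
theorem isDiscreteValuationRing_stalk (hπ : IsResolution π) {ζ : X} (hζ : Order.coheight ζ = 1) :
    IsDiscreteValuationRing (X.presheaf.stalk ζ) := by
  haveI := hπ.isRegular ζ
  haveI := isPrincipalIdealRing_stalk_of_coheight_eq_one hπ.isRegular hζ
  have hnf := not_isField_stalk_of_coheight_eq_one (X := X) hζ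
  exact ((IsDiscreteValuationRing.TFAE (X.presheaf.stalk ζ) hnf).out 0 4).mpr
    (IsPrincipalIdealRing.principal _)

/-- **LEMMA L (G1, sheaf half), codimension-one form.** Let `T` be a Noetherian local domain of Krull
dimension `2`, `π : X → Spec T` a resolution with `T → K(X)` injective, `F` an affine-localizing
(quasi-coherent) `𝒪_X`-module, `𝒰` a family of affine opens on which `Ȟ¹(𝒰, ·)` is right exact on
short exact sequences with affine-localizing kernel (`H² = 0`, Görtz–Wedhorn II Cor. 24.44, via
`Morphisms.GortzWedhorn2023_24_44_H2.cechMapH1_surjective`), and suppose `𝔞 := ann_T Ȟ¹(𝒰, F) ⊇ 𝔪ᶜ`.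
Then `𝔞` is CARRIED by the codimension-one points of the closed fibre: for `Z ζ := ord_ζ(𝔞𝒪_X)`,
`t ∈ 𝔞 ↔ t = 0 ∨ ∀ ζ` over `𝔪` of codimension one, `Z ζ ≤ ord_ζ(t)`. OURS (Q-rat Lemma A (A2)–(A4)).
[folklore] -/
theorem annihilator_cechMH1_isCarried_coheight (hπ : IsResolution π) (hdimT : ringKrullDim T = 2)
    (hinj : Function.Injective (baseToFunctionField π))
    (F : X.Modules) (hF : IsAffineLocalizing F) {ι : Type} (U : ι → X.Opens)
    (hUaff : ∀ i, IsAffineOpen (U i))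
    (hRE : ∀ S : ShortComplex X.Modules, S.ShortExact → IsAffineLocalizing S.X₁ →
      Function.Surjective (cechMapH1 π S.g U))
    {c : ℕ} (hc : maximalIdeal T ^ c ≤ Module.annihilator T (CechMH1 π F U)) :
    ∃ Z : X → ℕ, ∀ t : T, t ∈ Module.annihilator T (CechMH1 π F U) ↔
      (t = 0 ∨ ∀ ζ : X, π.base ζ = closedPoint T → Order.coheight ζ = 1 →
        (Z ζ : ℤ) ≤ Scheme.ord (baseToFunctionField π t) ζ) := by
  classical
  haveI : IsProper π := hπ.isProper
  haveI : IsNoetherian X := by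
    haveI : CompactSpace X := QuasiCompact.compactSpace_of_compactSpace π
    exact {}
  have hX : Scheme.IsRegular X := hπ.isRegular
  set 𝔞 : Ideal T := Module.annihilator T (CechMH1 π F U) with h𝔞
  set I : X.IdealSheafData := Scheme.IdealSheafData.ofIdealTop (𝔞.map (algebraMapΓ π)) with hIdef
  -- `𝔞 ≠ 0`, hence `I ≠ 0`
  have h𝔪 : maximalIdeal T ≠ ⊥ := by
    intro h
    have hf : IsField T := IsLocalRing.isField_iff_maximalIdeal_eq.mpr h
    have h0 := ringKrullDim_eq_zero_of_isField hf
    rw [hdimT] at h0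
    exact absurd h0 (by decide)
  obtain ⟨t₀, ht₀𝔞, ht₀⟩ : ∃ t₀ ∈ 𝔞, t₀ ≠ 0 := by
    have h1 : maximalIdeal T ^ c ≠ ⊥ := pow_ne_zero c h𝔪
    obtain ⟨t₀, ht₀, hne⟩ := Submodule.exists_mem_ne_zero_of_ne_bot h1
    exact ⟨t₀, hc ht₀, hne⟩
  have hb : ∀ t : T, baseToFunctionField π t =
      (X.presheaf.germ ⊤ (genericPoint X) trivial).hom (algebraMapΓ π t) := fun t => rfl
  have hgerm_ne : ∀ {t : T}, t ≠ 0 → ∀ x : X,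
      (X.presheaf.germ ⊤ x trivial).hom (algebraMapΓ π t) ≠ 0 := by
    intro t ht x h0
    apply ht
    apply hinj
    rw [map_zero, hb,
      ← Literature.AlgebraicGeometry.Motives.RatFn.toFunctionField_germ (x := x) (U := ⊤) trivial]
    change Literature.AlgebraicGeometry.Motives.RatFn.toFunctionField x
      ((X.presheaf.germ ⊤ x trivial).hom (algebraMapΓ π t)) = 0
    rw [h0, map_zero]
  have hIne : I ≠ ⊥ := by
    intro hI
    obtain ⟨V, hV, hξV, -⟩ := exists_isAffineOpen_mem_and_subset (X := X) (x := genericPoint X)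
      (U := ⊤) (Opens.mem_top _)
    have h1 : I.ideal ⟨V, hV⟩ = ⊥ := by rw [hI, Scheme.IdealSheafData.ideal_bot]; rfl
    rw [hIdef, Scheme.IdealSheafData.ofIdealTop_ideal, Ideal.map_map] at h1
    have h2 := Ideal.mem_map_of_mem
      ((X.presheaf.map (homOfLE (le_top : V ≤ ⊤)).op).hom.comp (algebraMapΓ π)) ht₀𝔞
    rw [h1, Ideal.mem_bot, RingHom.comp_apply] at h2
    apply hgerm_ne ht₀ (genericPoint X)
    rw [← TopCat.Presheaf.germ_res_apply X.presheaf (homOfLE (le_top : V ≤ ⊤)) (genericPoint X) hξV,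
      h2, map_zero]
  -- the divisorial decomposition `I = H·J`
  set H := divisorialPart I with hHdef
  set J := codimTwoPart I with hJdef
  have hIH : I ≤ H := le_divisorialPart hX hIne
  have hHJ : H * J = I := divisorialPart_mul_codimTwoPart hX hIne
  -- `V(J)` is a finite set of closed points
  have hcoh2 : ∀ x : X, Order.coheight x ≤ 2 := fun x =>
    le_trans (le_add_self) (hπ.height_add_coheight_le_two hdimT.le x)
  have hJcl : ∀ p ∈ (J.support : Set X), IsClosed ({p} : Set X) := fun p hp =>
    isClosed_singleton_of_one_lt_coheight hcoh2 (one_lt_coheight_of_mem_support_codimTwoPart hX hIne hp)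
  have hJfin : (J.support : Set X).Finite :=
    finite_of_isClosed_of_forall_isClosed_singleton J.support.isClosed hJcl
  -- (1) `Ȟ¹(HF) → Ȟ¹(F)` vanishes
  obtain ⟨gens, hgens⟩ := (inferInstance : IsNoetherianRing T).noetherian 𝔞
  have hIspan : I = Scheme.IdealSheafData.ofIdealTop
      (Ideal.span ((algebraMapΓ π) '' (gens : Set T))) := by
    rw [hIdef, ← hgens, Ideal.map_span]
  have hN : ∀ y : CechMH1 π (idealMul F H) U, cechMapH1 π (idealMulι F H) U y = 0 := by
    intro y
    obtain ⟨y', rfl⟩ := cechMapH1_idealMulMono_surjective π F U hF hHJ hIH hJfin hJcl hUaff y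
    rw [← cechMapH1_comp, idealMulMono_ι]
    have hgens𝔞 : ∀ a ∈ gens, ∀ x : CechMH1 π F U, a • x = 0 := by
      intro a ha x
      have ha𝔞 : a ∈ 𝔞 := by rw [← hgens]; exact Ideal.subset_span ha
      exact Module.mem_annihilator.mp ha𝔞 x
    have key := cechMapH1_idealMulι_span_eq_zero π F U hF hUaff hRE gens hgens𝔞
    rw [← hIspan] at key
    exact key y'
  -- the cycle: `Z ζ = ord_ζ(I)` at codimension-one points of `V(I)`, `0` elsewhere
  refine ⟨fun ζ => if ζ ∈ divisorialPoints I then (idealOrder I ζ).toNat else 0, fun t => ?_⟩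
  by_cases ht : t = 0
  · subst ht
    simp only [true_or, iff_true]
    exact Submodule.zero_mem _
  simp only [ht, false_or]
  constructor
  · -- (→) `t ∈ 𝔞`: `t𝒪_X ≤ I ≤ 𝓘_ζ^{ord_ζ I}`
    intro ht𝔞 ζ hζ𝔪 hζ
    haveI := isDiscreteValuationRing_stalk π hπ hζ
    by_cases hζI : ζ ∈ divisorialPoints I
    · rw [if_pos hζI, hb, natCast_le_ord_germ_iff hζ (hgerm_ne ht ζ)]
      rw [← stalkIdeal_eq_pow_of_mem_divisorialPoints hX hIne hζI, hIdef, stalkIdeal_ofIdealTop_map,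
        Ideal.span_singleton_le_iff_mem]
      exact Ideal.mem_map_of_mem _ ht𝔞
    · rw [if_neg hζI, Nat.cast_zero, hb]
      exact Literature.AlgebraicGeometry.Motives.RatFn.IsRegularAt.ord_nonneg
        ⟨_, Literature.AlgebraicGeometry.Motives.RatFn.toFunctionField_germ (Set.mem_univ ζ) _⟩
  · -- (←) the carried condition gives `t𝒪_X ≤ H`, so `t•` factors through `Ȟ¹(HF) → Ȟ¹(F) = 0`
    intro hcar
    have htH : ∀ V : X.affineOpens,
        X.presheaf.map (homOfLE (le_top : (V : X.Opens) ≤ ⊤)).op (algebraMapΓ π t) ∈ H.ideal V := by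
      have hle : Scheme.IdealSheafData.ofIdealTop (Ideal.span {algebraMapΓ π t}) ≤ H := by
        refine le_divisorialPart_of_forall_stalkIdeal_le hX hIne fun ζ hζI => ?_
        haveI := isDiscreteValuationRing_stalk π hπ hζI.2
        -- `ζ` lies over `𝔪` (off the closed fibre `I` is the unit ideal)
        have hζ𝔪 : π.base ζ = closedPoint T := by
          by_contra hne
          have htop := stalkIdeal_ofIdealTop_map_eq_top_of_base_ne π hc hne
          rw [← hIdef] at htop
          exact ((mem_support_iff_stalkIdeal_le I ζ).mp hζI.1 |>.trans_lt
            (lt_top_iff_ne_top.mpr (maximalIdeal.isMaximal _).ne_top)).ne htop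
        have h1 := hcar ζ hζ𝔪 hζI.2
        rw [if_pos hζI, hb, natCast_le_ord_germ_iff hζI.2 (hgerm_ne ht ζ)] at h1
        have e : stalkIdeal (Scheme.IdealSheafData.ofIdealTop (Ideal.span {algebraMapΓ π t})) ζ =
            Ideal.span {(X.presheaf.germ ⊤ ζ trivial).hom (algebraMapΓ π t)} := by
          have := stalkIdeal_ofIdealTop_map π (Ideal.span {t}) ζ
          rw [Ideal.map_span, Set.image_singleton] at this
          rw [this, Ideal.map_span, Set.image_singleton, RingHom.comp_apply]
        rw [e]
        exact h1
      exact forall_map_mem_ideal_of_ofIdealTop_span_le H (algebraMapΓ π t) hle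
    rw [Module.mem_annihilator]
    intro x
    rw [smul_eq_cechMapH1_of_fac π F U (globalScalarLift F H (algebraMapΓ π t) htH) (idealMulι F H) t
      (globalScalarLift_ι F H _ htH) x]
    exact hN _

/-- **LEMMA L (G1, sheaf half), exceptional-curve form** — the shape consumed by the typed target
`Sig.stubG_caCarried` (Ga) of the W4.4 skeleton: under the hypotheses of
`annihilator_cechMH1_isCarried_coheight` and the dictionary hypothesis «every codimension-one point
of the closed fibre is (the generic point of) an integral exceptional curve» (`hcodim`; its converse
is the tree's `IsResolution.coheight_eq_one_of_mem_excCurvePoints`), the annihilator of `Ȟ¹(𝒰, F)` is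
carried by the exceptional curves: `t ∈ 𝔞 ↔ t = 0 ∨ ∀ η ∈ excCurvePoints π, Z η ≤ ord_{E_η}(t)`.
OURS (Q-rat Lemma A (A4)). [folklore] -/
theorem annihilator_cechMH1_isCarried (hπ : IsResolution π) (hdimT : ringKrullDim T = 2)
    (hinj : Function.Injective (baseToFunctionField π))
    (hcodim : ∀ ζ : X, π.base ζ = closedPoint T → Order.coheight ζ = 1 → ζ ∈ excCurvePoints π)
    (F : X.Modules) (hF : IsAffineLocalizing F) {ι : Type} (U : ι → X.Opens)
    (hUaff : ∀ i, IsAffineOpen (U i))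
    (hRE : ∀ S : ShortComplex X.Modules, S.ShortExact → IsAffineLocalizing S.X₁ →
      Function.Surjective (cechMapH1 π S.g U))
    {c : ℕ} (hc : maximalIdeal T ^ c ≤ Module.annihilator T (CechMH1 π F U)) :
    ∃ Z : X → ℕ, ∀ t : T, t ∈ Module.annihilator T (CechMH1 π F U) ↔
      (t = 0 ∨ ∀ η ∈ excCurvePoints π, (Z η : ℤ) ≤ Scheme.ord (baseToFunctionField π t) η) := by
  obtain ⟨Z, hZ⟩ := annihilator_cechMH1_isCarried_coheight π hπ hdimT hinj F hF U hUaff hRE hc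
  refine ⟨Z, fun t => (hZ t).trans (or_congr_right ⟨fun h η hη => ?_, fun h ζ hζ𝔪 hζ => ?_⟩)⟩
  · exact h η hη.1 (hπ.coheight_eq_one_of_mem_excCurvePoints hdimT hη)
  · exact h ζ (hcodim ζ hζ𝔪 hζ)

end Main

end Summit.ResolutionOfSingularities.ResolutionOfSingularities.Theorems.NoZeno.SandwichCluster.LemmaL

end
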